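import Mathlib
import Summits.ValiantsHypothesis.ValiantsHypothesis.Theorems.BorderApolarityBorelFixedBorderApolarityTranslate
import Summits.ValiantsHypothesis.ValiantsHypothesis.Theorems.BorderApolarityBorelFixedBorderApolarityDescentA
import Summits.ValiantsHypothesis.ValiantsHypothesis.Theorems.BorderApolarityBorelFixedBorderApolarityDescentB
import Summits.ValiantsHypothesis.ValiantsHypothesis.Theorems.BorderApolarityBorelFixedBorderApolarityLowering
import Summits.ValiantsHypothesis.ValiantsHypothesis.Theorems.BorderApolarityBorelFixedBorderApolarityNonempty

/-!
# Crux `DetQP.DetqpThesis` (stmt-ValiantsHypothesis-0315), line `four-dimensional-determinant` —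
# the Borel-fixed descent for an ARBITRARY semi-invariant target (general form of `bfba_descent`)

Route `ValiantsHypothesis/BorderApolarity` proved (item 5781, `Theorems/BorderApolarityBorelFixedBorderApolarity*.lean`)
that the set `Y` of degree-wise Kuratowski limits `J = lim Ann(P_t)` (`P_t ∈ GL · det_m`) inside
the annihilator of the padded PERMANENT contains a point stable under the solvable group `H₀(n,m)`,
by an explicit descent replacing Borel's fixed point theorem.  The descent never looks inside the
target: it uses only (a) a weight `μ ≥ 0`, bounded on exponents of degree `≤ m`, for which the target
`f` is weighted homogeneous, (b) a class of substitutions `V` with unit diagonal which LOWER `μ`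
(`V a b ≠ 0`, `a ≠ b` ⇒ `μ a < μ b`), are invertible, and whose contragredient `(V⁻¹)ᵀ` fixes `f`,
and (c) the torus-limit operation `J ↦ in_μ(J)` on `Y_f`.  This file records that general form,
for use with the padded four-dimensional determinant `X₀₀^{m-n} H_n(X_ι)` and its group
`H(n,m,ι) ⊇ im B_n⁴` (line `four-dimensional-determinant` of crux `DetQP.DetqpThesis`, stub
`stub_borelFixed_of_parts`), and for any later target:

* `hdbf_translate` — `Y_f` is stable under `J ↦ {D : Aᵀ D ∈ J}` for invertible `A` with
  `A · f = c • f`, `c ≠ 0` (general form of `bfba_translate`);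
* `hdbf_descent` — given (a), (b) and the torus-limit property (c) as a hypothesis, every point of
  `Y_f` can be replaced by a `μ`-GRADED point of `Y_f` stable under every `V` of the class
  (general form of `bfba_descent`; the potential `Σ_{k ≤ m} Σ_{0 ≤ ν ≤ hi} dim (J_k ∩ F_{≥ν})`
  strictly drops at each move, by `bfba_rank_le` / `bfba_map_eq_of_rank_eq` / `bfba_rank_initSpan` /
  `bfba_lowering`, all of which are already target-free in the tree).

Adapted from `Theorems/BorderApolarityBorelFixedBorderApolarity.lean` (same sub-problem); folklore
(Borel 1991 Thm 10.4 replaced by explicit descent; Buczyńska–Buczyński 2021 Thm 31).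
-/

open MvPolynomial Filter
open scoped BigOperators Topology Matrix

namespace Summit.ValiantsHypothesis.ValiantsHypothesis.Theorems.DetQPDetqpThesis.HdBorelFixed

set_option linter.dupNamespace false

open Literature.Computability.AlgebraicComplexity
open Summit.ValiantsHypothesis.ValiantsHypothesis.Theorems.BorderApolarityToricFixedPoints
open Summit.ValiantsHypothesis.ValiantsHypothesis.Theorems.BorderApolarityFixedWitnessObstructionQP
  (stub_kuratowskiSubmodule stub_annSubmodule)
open Summit.ValiantsHypothesis.ValiantsHypothesis.Theorems.BorderApolarityBorelFixedBorderApolarity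

variable {m : ℕ}

/-- **`Y_f` is stable under translation** (general target).  Let `J` be the degree-wise (`k ≤ m`)
Kuratowski limit of `Ann(P_t)` with `P_t ∈ GL · det_m` and `J_k ⌟ f = 0` for `k ≤ m`.  For an
invertible `A` with `A · f = c • f`, `c ≠ 0`, the translate `{D : Aᵀ D ∈ J}` is again such a
limit (along `A · P_t ∈ GL · det_m`) inside `Ann(f)`. -/
theorem hdbf_translate (f : MvPolynomial (Fin m × Fin m) ℂ) (P : ℕ → MvPolynomial (Fin m × Fin m) ℂ)
    (hP : ∀ t, P t ∈ glOrbit (Fin m × Fin m) ℂ (detPoly (Fin m) ℂ))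
    (J : ℕ → Set (MvPolynomial (Fin m × Fin m) ℂ)) (hJ : IsBorderApolarLimit m P J)
    (hJf : ∀ k ≤ m, ∀ D ∈ J k, apolarAction D f = 0)
    (A : Matrix (Fin m × Fin m) (Fin m × Fin m) ℂ) (hA : IsUnit A.det) (c : ℂ) (hc : c ≠ 0)
    (hAf : linSubst (Fin m × Fin m) ℂ A f = c • f) :
    (∀ t, linSubst (Fin m × Fin m) ℂ A (P t) ∈ glOrbit (Fin m × Fin m) ℂ (detPoly (Fin m) ℂ)) ∧
    IsBorderApolarLimit m (fun t => linSubst (Fin m × Fin m) ℂ A (P t))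
      (fun k => {D | linSubst (Fin m × Fin m) ℂ Aᵀ D ∈ J k}) ∧
    (∀ k ≤ m, ∀ D ∈ {D | linSubst (Fin m × Fin m) ℂ Aᵀ D ∈ J k}, apolarAction D f = 0) := by
  refine ⟨fun t => bfba_linSubst_mem_glOrbit (hP t) A hA,
    bfba_isBorderApolarLimit_translate m P J hJ A hA, ?_⟩
  intro k hk D hD
  have h1 : apolarAction (linSubst (Fin m × Fin m) ℂ Aᵀ D) f = 0 := hJf k hk _ hD
  have h2 : apolarAction D (linSubst (Fin m × Fin m) ℂ A f) = 0 :=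
    (apolarAction_linSubst_eq_zero_iff A hA D _).2 h1
  rw [hAf, apolarAction_smul_right] at h2
  exact (smul_eq_zero.1 h2).resolve_left hc

/-- **The descent (general target, abstract lowering class).**  Notation: `Y` = degree-wise (`k ≤ m`) limits `J` of `Ann(P_t)`,
`P_t ∈ GL · det_m`, with `J_k ⌟ pp = 0`; `μ` a weight with `pp` weighted homogeneous, `μ ≥ 0`,
weights of degree `≤ m` bounded by `hi`, anti-dominant for the order `rk`.  For every `μ`-graded
`J ∈ Y` whose rank profile `Σ_{k ≤ m} Σ_{0 ≤ ν ≤ hi} dim (J_k ∩ F_{≥ν})` is at most `p` there is a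
`μ`-graded `J' ∈ Y` stable under every unit lower-triangular `V` supported on the unused rows
(induction on `p`: if some such `V` moves `J`, then `in_μ(V · J) ∈ Y` is graded with strictly
smaller rank profile, by `bfba_rank_le` / `bfba_map_eq_of_rank_eq` / `bfba_rank_initSpan`).
-/
theorem hdbf_descent (f : MvPolynomial (Fin m × Fin m) ℂ) (μ : Fin m × Fin m → ℤ)
    (hμ0 : ∀ v, 0 ≤ μ v) (hi : ℤ)
    (hμhi : ∀ e : Fin m × Fin m →₀ ℕ, e.degree ≤ m → Finsupp.weight μ e ≤ hi)
    (IsV : Matrix (Fin m × Fin m) (Fin m × Fin m) ℂ → Prop)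
    (hV1 : ∀ V, IsV V → ∀ a, V a a = 1)
    (hVμ : ∀ V, IsV V → ∀ a b, a ≠ b → V a b ≠ 0 → μ a < μ b)
    (hVdet : ∀ V, IsV V → IsUnit V.det)
    (hVf : ∀ V, IsV V → linSubst (Fin m × Fin m) ℂ (V⁻¹)ᵀ f = f)
    (hTL : ∀ (P : ℕ → MvPolynomial (Fin m × Fin m) ℂ) (J : ℕ → Set (MvPolynomial (Fin m × Fin m) ℂ)),
      (∀ t, P t ∈ glOrbit (Fin m × Fin m) ℂ (detPoly (Fin m) ℂ)) → IsBorderApolarLimit m P J →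
      (∀ k ≤ m, ∀ D ∈ J k, apolarAction D f = 0) →
      ∃ (P' : ℕ → MvPolynomial (Fin m × Fin m) ℂ) (J' : ℕ → Set (MvPolynomial (Fin m × Fin m) ℂ)),
        (∀ t, P' t ∈ glOrbit (Fin m × Fin m) ℂ (detPoly (Fin m) ℂ)) ∧ IsBorderApolarLimit m P' J' ∧
        (∀ k ≤ m, ∀ D ∈ J' k, apolarAction D f = 0) ∧
        (∀ k, ∀ D, D ∈ J' k ↔ D ∈ Submodule.span ℂ {D' : MvPolynomial (Fin m × Fin m) ℂ |
            ∃ E ∈ J k, ∃ ν : ℤ, D' = weightedHomogeneousComponent μ ν E ∧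
              ∀ ν' : ℤ, ν' < ν → weightedHomogeneousComponent μ ν' E = 0})) :
    ∀ (p : ℕ) (P : ℕ → MvPolynomial (Fin m × Fin m) ℂ) (J : ℕ → Set (MvPolynomial (Fin m × Fin m) ℂ)),
      (∀ t, P t ∈ glOrbit (Fin m × Fin m) ℂ (detPoly (Fin m) ℂ)) → IsBorderApolarLimit m P J →
      (∀ k ≤ m, ∀ D ∈ J k, apolarAction D f = 0) →
      (∀ k ≤ m, ∀ D ∈ J k, ∀ ν : ℤ, weightedHomogeneousComponent μ ν D ∈ J k) →
      (∑ k ∈ Finset.range (m + 1), ∑ ν ∈ Finset.Icc (0 : ℤ) hi,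
          Module.finrank ℂ ↥(Submodule.span ℂ (J k) ⊓
            restrictSupport ℂ {e : Fin m × Fin m →₀ ℕ | ν ≤ Finsupp.weight μ e})) ≤ p →
      ∃ (P' : ℕ → MvPolynomial (Fin m × Fin m) ℂ) (J' : ℕ → Set (MvPolynomial (Fin m × Fin m) ℂ)),
        (∀ t, P' t ∈ glOrbit (Fin m × Fin m) ℂ (detPoly (Fin m) ℂ)) ∧ IsBorderApolarLimit m P' J' ∧
        (∀ k ≤ m, ∀ D ∈ J' k, apolarAction D f = 0) ∧
        (∀ k ≤ m, ∀ D ∈ J' k, ∀ ν : ℤ, weightedHomogeneousComponent μ ν D ∈ J' k) ∧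
        (∀ V : Matrix (Fin m × Fin m) (Fin m × Fin m) ℂ, IsV V →
          ∀ k ≤ m, ∀ D ∈ J' k, linSubst (Fin m × Fin m) ℂ V D ∈ J' k) := by
  classical
  haveI hfin : ∀ k, Module.Finite ℂ (homogeneousSubmodule (Fin m × Fin m) ℂ k) := fun k =>
    Module.Finite.iff_fg.2 (homogeneousSubmodule_fg _ ℂ k)
  have hw0 : ∀ e : Fin m × Fin m →₀ ℕ, 0 ≤ Finsupp.weight μ e := bfba_weight_nonneg μ hμ0
  -- the descent step
  have hstep : ∀ (P : ℕ → MvPolynomial (Fin m × Fin m) ℂ) (J : ℕ → Set (MvPolynomial (Fin m × Fin m) ℂ)),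
      (∀ t, P t ∈ glOrbit (Fin m × Fin m) ℂ (detPoly (Fin m) ℂ)) → IsBorderApolarLimit m P J →
      (∀ k ≤ m, ∀ D ∈ J k, apolarAction D f = 0) →
      (∀ k ≤ m, ∀ D ∈ J k, ∀ ν : ℤ, weightedHomogeneousComponent μ ν D ∈ J k) →
      ∀ V : Matrix (Fin m × Fin m) (Fin m × Fin m) ℂ, IsV V →
        ∀ k₀ ≤ m, ∀ D₀ ∈ J k₀, linSubst (Fin m × Fin m) ℂ V D₀ ∉ J k₀ →
        ∃ (P' : ℕ → MvPolynomial (Fin m × Fin m) ℂ) (J' : ℕ → Set (MvPolynomial (Fin m × Fin m) ℂ)),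
          (∀ t, P' t ∈ glOrbit (Fin m × Fin m) ℂ (detPoly (Fin m) ℂ)) ∧ IsBorderApolarLimit m P' J' ∧
          (∀ k ≤ m, ∀ D ∈ J' k, apolarAction D f = 0) ∧
          (∀ k ≤ m, ∀ D ∈ J' k, ∀ ν : ℤ, weightedHomogeneousComponent μ ν D ∈ J' k) ∧
          (∑ k ∈ Finset.range (m + 1), ∑ ν ∈ Finset.Icc (0 : ℤ) hi,
              Module.finrank ℂ ↥(Submodule.span ℂ (J' k) ⊓
                restrictSupport ℂ {e : Fin m × Fin m →₀ ℕ | ν ≤ Finsupp.weight μ e})) <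
            ∑ k ∈ Finset.range (m + 1), ∑ ν ∈ Finset.Icc (0 : ℤ) hi,
              Module.finrank ℂ ↥(Submodule.span ℂ (J k) ⊓
                restrictSupport ℂ {e : Fin m × Fin m →₀ ℕ | ν ≤ Finsupp.weight μ e}) := by
    intro P J hP hJ hJpp hgr V hVmem k₀ hk₀ D₀ hD₀ hnot
    -- `V` is an invertible lowering substitution
    have hlow := bfba_lowering μ V (hV1 V hVmem) (hVμ V hVmem)
    have hVu : IsUnit V.det := hVdet V hVmem
    set Φ : MvPolynomial (Fin m × Fin m) ℂ →ₗ[ℂ] MvPolynomial (Fin m × Fin m) ℂ :=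
      (linSubst (Fin m × Fin m) ℂ V).toLinearMap with hΦ
    have hΦapp : ∀ x, Φ x = linSubst (Fin m × Fin m) ℂ V x := fun x => rfl
    have hΦinj : Function.Injective Φ := fun x y h => linSubst_injective_of_isUnit_det V hVu h
    have hlowΦ : ∀ (ν : ℤ) (D : MvPolynomial (Fin m × Fin m) ℂ),
        (∀ e ∈ D.support, Finsupp.weight μ e ≤ ν) → ∀ e ∈ (Φ D - D).support, Finsupp.weight μ e < ν :=
      fun ν D hD => hlow ν D hD
    -- the translating matrix `A = (V⁻¹)ᵀ` fixes `pp`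
    set A : Matrix (Fin m × Fin m) (Fin m × Fin m) ℂ := (V⁻¹)ᵀ with hA
    have hAunit : IsUnit A.det := by
      rw [hA, Matrix.det_transpose]
      exact Matrix.isUnit_nonsing_inv_det V hVu
    have hAT : Aᵀ = V⁻¹ := Matrix.transpose_transpose _
    have hApp : linSubst (Fin m × Fin m) ℂ A f = (1 : ℂ) • f := by
      rw [one_smul, hA]
      exact hVf V hVmem
    -- translate, then take the torus limit
    obtain ⟨hP₁, hJ₁, hJ₁pp⟩ := hdbf_translate f P hP J hJ hJpp A hAunit 1 one_ne_zero hApp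
    obtain ⟨P₂, J₂, hP₂, hJ₂, hJ₂pp, hJ₂in⟩ := hTL _ _ hP₁ hJ₁ hJ₁pp
    have hgr₂ : ∀ k ≤ m, ∀ D ∈ J₂ k, ∀ ν : ℤ, weightedHomogeneousComponent μ ν D ∈ J₂ k :=
      fun k _ D hD ν => (hJ₂in k _).2 (bfba_initSpan_graded_set μ _ D ((hJ₂in k D).1 hD) ν)
    refine ⟨P₂, J₂, hP₂, hJ₂, hJ₂pp, hgr₂, ?_⟩
    -- the subspaces
    obtain hL := bfba_exists_submodule P hP J hJ
    -- rank comparison, degree by degree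
    have hcmp : ∀ k ≤ m, ∀ ν : ℤ,
        Module.finrank ℂ ↥(Submodule.span ℂ (J₂ k) ⊓
            restrictSupport ℂ {e : Fin m × Fin m →₀ ℕ | ν ≤ Finsupp.weight μ e}) ≤
          Module.finrank ℂ ↥(Submodule.span ℂ (J k) ⊓
            restrictSupport ℂ {e : Fin m × Fin m →₀ ℕ | ν ≤ Finsupp.weight μ e}) ∧
        (Module.finrank ℂ ↥(Submodule.span ℂ (J₂ k) ⊓
            restrictSupport ℂ {e : Fin m × Fin m →₀ ℕ | ν ≤ Finsupp.weight μ e}) =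
          Module.finrank ℂ ↥(Submodule.span ℂ (J k) ⊓
            restrictSupport ℂ {e : Fin m × Fin m →₀ ℕ | ν ≤ Finsupp.weight μ e}) →
          Module.finrank ℂ ↥((Submodule.span ℂ (J k)).map Φ ⊓
            restrictSupport ℂ {e : Fin m × Fin m →₀ ℕ | ν ≤ Finsupp.weight μ e}) =
          Module.finrank ℂ ↥(Submodule.span ℂ (J k) ⊓
            restrictSupport ℂ {e : Fin m × Fin m →₀ ℕ | ν ≤ Finsupp.weight μ e})) := by
      intro k hk ν
      obtain ⟨Lk, hLk, hLkle, -⟩ := hL k hk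
      have hspan : Submodule.span ℂ (J k) = Lk := by rw [← hLk]; exact Submodule.span_eq Lk
      have hmemLk : ∀ E, E ∈ Lk ↔ E ∈ J k := fun E => by rw [← SetLike.mem_coe, hLk]
      haveI : FiniteDimensional ℂ Lk := Submodule.finiteDimensional_of_le hLkle
      have hgrLk : ∀ D ∈ Lk, ∀ ν : ℤ, weightedHomogeneousComponent μ ν D ∈ Lk :=
        fun D hD ν => (hmemLk _).2 (hgr k hk D ((hmemLk D).1 hD) ν)
      -- `J₂ k` is the initial span of `V · Lk`
      set L₁ : Submodule ℂ (MvPolynomial (Fin m × Fin m) ℂ) := Lk.map Φ with hL₁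
      have hL₁le : L₁ ≤ homogeneousSubmodule (Fin m × Fin m) ℂ k := by
        rintro _ ⟨E, hE, rfl⟩
        rw [hΦapp]
        exact linSubst_mem_homogeneousSubmodule V (hLkle hE)
      have hmemL₁ : ∀ E, E ∈ L₁ ↔ linSubst (Fin m × Fin m) ℂ Aᵀ E ∈ J k := by
        intro E
        rw [hAT]
        constructor
        · rintro ⟨F, hF, rfl⟩
          rw [hΦapp, bfba_linSubst_inv_linSubst V hVu]
          exact (hmemLk F).1 hF
        · intro h
          refine ⟨linSubst (Fin m × Fin m) ℂ V⁻¹ E, (hmemLk _).2 h, ?_⟩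
          rw [hΦapp, bfba_linSubst_linSubst_inv V hVu]
      have hset : {D' : MvPolynomial (Fin m × Fin m) ℂ |
            ∃ E ∈ {D : MvPolynomial (Fin m × Fin m) ℂ | linSubst (Fin m × Fin m) ℂ Aᵀ D ∈ J k}, ∃ ν : ℤ,
              D' = weightedHomogeneousComponent μ ν E ∧
                ∀ ν' : ℤ, ν' < ν → weightedHomogeneousComponent μ ν' E = 0} =
          {D' : MvPolynomial (Fin m × Fin m) ℂ | ∃ E ∈ L₁, ∃ ν : ℤ,
              D' = weightedHomogeneousComponent μ ν E ∧
                ∀ ν' : ℤ, ν' < ν → weightedHomogeneousComponent μ ν' E = 0} := by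
        ext D'
        simp only [Set.mem_setOf_eq, hmemL₁]
      have hspan₂ : Submodule.span ℂ (J₂ k) = Submodule.span ℂ {D' : MvPolynomial (Fin m × Fin m) ℂ |
          ∃ E ∈ L₁, ∃ ν : ℤ, D' = weightedHomogeneousComponent μ ν E ∧
            ∀ ν' : ℤ, ν' < ν → weightedHomogeneousComponent μ ν' E = 0} := by
        have hcoe : J₂ k = (Submodule.span ℂ {D' : MvPolynomial (Fin m × Fin m) ℂ |
            ∃ E ∈ L₁, ∃ ν : ℤ, D' = weightedHomogeneousComponent μ ν E ∧
              ∀ ν' : ℤ, ν' < ν → weightedHomogeneousComponent μ ν' E = 0} :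
                Set (MvPolynomial (Fin m × Fin m) ℂ)) := by
          ext D
          rw [hJ₂in k D, hset, SetLike.mem_coe]
        rw [hcoe, Submodule.span_eq]
      rw [hspan₂, bfba_rank_initSpan μ k L₁ hL₁le ν, hspan]
      exact ⟨bfba_rank_le μ Lk hgrLk Φ hΦinj hlowΦ ν, fun h => h⟩
    -- strictness in degree `k₀`
    obtain ⟨Lk₀, hLk₀, hLk₀le, -⟩ := hL k₀ hk₀
    have hspan₀ : Submodule.span ℂ (J k₀) = Lk₀ := by rw [← hLk₀]; exact Submodule.span_eq Lk₀
    have hmemLk₀ : ∀ E, E ∈ Lk₀ ↔ E ∈ J k₀ := fun E => by rw [← SetLike.mem_coe, hLk₀]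
    haveI : FiniteDimensional ℂ Lk₀ := Submodule.finiteDimensional_of_le hLk₀le
    have hgrLk₀ : ∀ D ∈ Lk₀, ∀ ν : ℤ, weightedHomogeneousComponent μ ν D ∈ Lk₀ :=
      fun D hD ν => (hmemLk₀ _).2 (hgr k₀ hk₀ D ((hmemLk₀ D).1 hD) ν)
    have hne : Lk₀.map Φ ≠ Lk₀ := by
      intro heq
      apply hnot
      rw [← hmemLk₀, ← heq]
      exact ⟨D₀, (hmemLk₀ _).2 hD₀, rfl⟩
    have hex : ∃ ν₁ : ℤ, ν₁ ∈ Finset.Icc (0 : ℤ) hi ∧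
        Module.finrank ℂ ↥(Lk₀.map Φ ⊓ restrictSupport ℂ {e : Fin m × Fin m →₀ ℕ | ν₁ ≤ Finsupp.weight μ e}) ≠
          Module.finrank ℂ ↥(Lk₀ ⊓ restrictSupport ℂ {e : Fin m × Fin m →₀ ℕ | ν₁ ≤ Finsupp.weight μ e}) := by
      by_contra hall
      push Not at hall
      apply hne
      refine bfba_map_eq_of_rank_eq μ Lk₀ hgrLk₀ Φ hΦinj hlowΦ fun ν => ?_
      by_cases hν : ν ∈ Finset.Icc (0 : ℤ) hi
      · exact hall ν hν
      rw [Finset.mem_Icc, not_and_or, not_le, not_le] at hν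
      rcases hν with hν | hν
      · -- `ν < 0`: `F_{≥ν}` is everything
        have htop : ∀ W : Submodule ℂ (MvPolynomial (Fin m × Fin m) ℂ),
            W ⊓ restrictSupport ℂ {e : Fin m × Fin m →₀ ℕ | ν ≤ Finsupp.weight μ e} = W := by
          intro W
          refine le_antisymm inf_le_left fun D hD => Submodule.mem_inf.2 ⟨hD, ?_⟩
          rw [bfba_mem_Fge]
          intro e _
          exact (hν.le.trans (hw0 e))
        rw [htop, htop]
        exact LinearEquiv.finrank_eq (Submodule.equivMapOfInjective Φ hΦinj Lk₀).symm
      · -- `hi < ν`: `F_{≥ν}` meets degree-`k₀` forms trivially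
        have hbot : ∀ W : Submodule ℂ (MvPolynomial (Fin m × Fin m) ℂ),
            W ≤ homogeneousSubmodule (Fin m × Fin m) ℂ k₀ →
            W ⊓ restrictSupport ℂ {e : Fin m × Fin m →₀ ℕ | ν ≤ Finsupp.weight μ e} = ⊥ := by
          intro W hW
          rw [eq_bot_iff]
          rintro D ⟨hDW, hDF⟩
          rw [Submodule.mem_bot]
          by_contra hD0
          obtain ⟨e, he⟩ := Finset.nonempty_of_ne_empty (mt support_eq_empty.1 hD0)
          have hdeg : e.degree = k₀ := by
            rw [Finsupp.degree_eq_weight_one]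
            exact (mem_homogeneousSubmodule k₀ D).1 (hW hDW) (mem_support_iff.1 he)
          have h1 := hμhi e (hdeg.le.trans hk₀)
          have h2 := (bfba_mem_Fge μ).1 hDF e he
          omega
        have hmaple : Lk₀.map Φ ≤ homogeneousSubmodule (Fin m × Fin m) ℂ k₀ := by
          rintro _ ⟨E, hE, rfl⟩
          rw [hΦapp]
          exact linSubst_mem_homogeneousSubmodule V (hLk₀le hE)
        rw [hbot _ hmaple, hbot _ hLk₀le]
    obtain ⟨ν₁, hν₁, hν₁ne⟩ := hex
    -- sum up
    refine Finset.sum_lt_sum (fun k hk => Finset.sum_le_sum fun ν _ =>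
      (hcmp k (Nat.lt_succ_iff.1 (Finset.mem_range.1 hk)) ν).1) ⟨k₀, Finset.mem_range.2 (Nat.lt_succ_of_le hk₀), ?_⟩
    refine Finset.sum_lt_sum (fun ν _ => (hcmp k₀ hk₀ ν).1) ⟨ν₁, hν₁, ?_⟩
    refine lt_of_le_of_ne (hcmp k₀ hk₀ ν₁).1 fun heq => hν₁ne ?_
    have h := (hcmp k₀ hk₀ ν₁).2 heq
    rwa [hspan₀] at h
  -- induction on the potential
  intro p
  induction p with
  | zero =>
    intro P J hP hJ hJpp hgr hpot
    by_cases hstab : ∀ V : Matrix (Fin m × Fin m) (Fin m × Fin m) ℂ, IsV V →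
        ∀ k ≤ m, ∀ D ∈ J k, linSubst (Fin m × Fin m) ℂ V D ∈ J k
    · exact ⟨P, J, hP, hJ, hJpp, hgr, hstab⟩
    · simp only [not_forall, exists_prop] at hstab
      obtain ⟨V, hVmem, k₀, hk₀, D₀, hD₀, hnot⟩ := hstab
      obtain ⟨P', J', -, -, -, -, hlt⟩ := hstep P J hP hJ hJpp hgr V hVmem k₀ hk₀ D₀ hD₀ hnot
      omega
  | succ p ih =>
    intro P J hP hJ hJpp hgr hpot
    by_cases hstab : ∀ V : Matrix (Fin m × Fin m) (Fin m × Fin m) ℂ, IsV V →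
        ∀ k ≤ m, ∀ D ∈ J k, linSubst (Fin m × Fin m) ℂ V D ∈ J k
    · exact ⟨P, J, hP, hJ, hJpp, hgr, hstab⟩
    · simp only [not_forall, exists_prop] at hstab
      obtain ⟨V, hVmem, k₀, hk₀, D₀, hD₀, hnot⟩ := hstab
      obtain ⟨P', J', hP', hJ', hJ'pp, hgr', hlt⟩ := hstep P J hP hJ hJpp hgr V hVmem k₀ hk₀ D₀ hD₀ hnot
      exact ih P' J' hP' hJ' hJ'pp hgr' (by omega)

end Summit.ValiantsHypothesis.ValiantsHypothesis.Theorems.DetQPDetqpThesis.HdBorelFixed
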